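import Summits.ResolutionOfSingularities.ResolutionOfSingularities.Theorems.WeightedInvariantLocalWeightedDropTrackT4Step
import Summits.ResolutionOfSingularities.ResolutionOfSingularities.Theorems.WeightedInvariantLocalWeightedDropTrackCSurfaceGermsWonB

/-!
# Track T4: the one-entry tuple game on `k⟦x₀,x₁,x₂⟧` is won, modulo the corrected Cossart–Jannsen–Saito fact F-32bR

[OURS · L1 W4.3 · chain w43, Track T4 (tame double points at N = 4 modulo F-32bR), bricks B3 end/base + B4; stub worker 4] Engine
crux `LocalWeightedDrop` (stmt-ResolutionOfSingularities-8899).  NOT a statement of any manuscript; the games are the programme's own.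

`tupleDropThreeZero_of_CJSB : CossartJannsenSaito2020EmbeddedSequenceB → ∀ k, TupleGame.Drop k 3 0` — order reduction of ONE marked
germ `(a₀, 2)` on the regular local threefold `Spec k⟦x₀,x₁,x₂⟧` in the positional form of the coefficient-tuple game, for EVERY field
`k` (no characteristic hypothesis: all moves are `{0,1}`-weighted), modulo the printed fact F-32bR (Cossart–Jannsen–Saito, LNM 2270, Thm.
1.4 + Thm. 6.9 (a), tree decl `CossartJannsenSaito2020EmbeddedSequenceB`).  The proof follows the embedded resolution SEQUENCE of
`V(a₀) ⊆ Z₀` (`TrackC.exists_sequence_zeroLocusB`) exactly as Track C does for the hypersurface game: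
* END `tWonAt_end` — at the end every total transform reads, in some frame, as a unit times a monomial (`TrackC.exists_monomial_frame_end`);
  its divisors are won by the monomial end-game `TupleMonomial.tWon_of_dvd_unit_mul_prod`, transported along the change of frame
  (`tWon_of_tWon_subst`: the tuple game absorbs formal coordinate changes into its next move);
* STEP `tWonAt_of_tWonAt_blowup` (`…TrackT4Step`), INDUCTION `tWonAt_transformerB` along `IsBPermissibleSequenceB` (`TrackC.forwardB`,
  `TrackC.centre_ne_bot_B`);
* BASE `tWon_of_tWonAt_id` — the tautological frame at the closed point (`TrackC.exists_tautological_frame`);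
* RANK EXTRACTION `TupleGame.drop_of_allTWon` (`…TupleGameWon`).
The `N = 4` consequence for the hypersurface game (tame double points in four variables) is in `…TrackT4DoublePoints`.
-/

noncomputable section

open CategoryTheory CategoryTheory.Limits AlgebraicGeometry TopologicalSpace IsLocalRing
open Literature.AlgebraicGeometry.Resolution
open Literature.AlgebraicGeometry.Resolution.TupleGame
open Scheme.IdealSheafData

set_option linter.dupNamespace false -- mandated namespace of this single-conjunct summit

namespace Summit.ResolutionOfSingularities.ResolutionOfSingularities.Theorems.TrackT4

open TrackC TupleGame TupleMonomial

variable {k : Type} [Field k]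

/-! ## Coordinate changes are absorbed by the next move -/

/-- A legal formal coordinate change is injective on series: `φ^* b = 0 → b = 0`. [OURS · folklore] -/
theorem eq_zero_of_subst_eq_zero {m : ℕ} {φ : Fin m → MvPowerSeries (Fin m) k}
    (hφ0 : ∀ i, MvPowerSeries.constantCoeff (φ i) = 0) (hφdet : IsUnit (FormalCoordChange.linMat φ).det)
    {b : MvPowerSeries (Fin m) k} (hb : MvPowerSeries.subst φ b = 0) : b = 0 := by
  obtain ⟨ψ, hψ0, hψφ, -⟩ := FormalCoordChange.exists_comp_inverse hφ0 hφdet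
  have hψs : MvPowerSeries.HasSubst ψ := MvPowerSeries.hasSubst_of_constantCoeff_zero hψ0
  rw [← subst_subst_of_comp_eq_X hφ0 hψ0 hψφ b, hb, ← MvPowerSeries.coe_substAlgHom hψs, map_zero]

/-- **Transport of `TWon` along a coordinate change (one-entry tuples).** If `φ^* b` is won then so is `b`: play
`(Φ ∘ φ, w, sel)` instead of `(Φ, w, sel)` — the transforms, hence the successors, are the same series. [OURS · folklore] -/
theorem tWon_of_tWon_subst {m : ℕ} {φ : Fin m → MvPowerSeries (Fin m) k}
    (hφ0 : ∀ i, MvPowerSeries.constantCoeff (φ i) = 0) (hφdet : IsUnit (FormalCoordChange.linMat φ).det)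
    {b : MvPowerSeries (Fin m) k} (h : TWon k m 0 (fun _ : Fin (0 + 1) => MvPowerSeries.subst φ b)) :
    TWon k m 0 (fun _ : Fin (0 + 1) => b) := by
  obtain ⟨Φ, w, sel, hΦ0, hΦdet, hw1, hw, hs⟩ := h.exists_isTMove
  refine TWon.of_isTMove (Φ := fun i => MvPowerSeries.subst Φ (φ i)) (w := w) (sel := sel)
    ⟨constantCoeff_comp_eq_zero hφ0 hΦ0, ?_, hw1, hw, fun c hc0 hc D G hDG => ?_⟩
  · change IsUnit (FormalCoordChange.linMat fun i => MvPowerSeries.subst Φ (φ i)).det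
    rw [linMat_comp φ hΦ0, Matrix.det_mul]
    exact hφdet.mul hΦdet
  · have hφs : MvPowerSeries.HasSubst φ := MvPowerSeries.hasSubst_of_constantCoeff_zero hφ0
    have hφz : MvPowerSeries.subst φ (0 : MvPowerSeries (Fin m) k) = 0 := by
      rw [← MvPowerSeries.coe_substAlgHom hφs, map_zero]
    have hDG' : ∀ j : Fin (0 + 1), (fun _ : Fin (0 + 1) => MvPowerSeries.subst φ b) j ≠ 0 →
        MvPowerSeries.subst (CobordantChart.chart w c) (MvPowerSeries.subst Φ
          ((fun _ : Fin (0 + 1) => MvPowerSeries.subst φ b) j)) = MvPowerSeries.X 0 ^ D j * G j ∧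
          ¬ MvPowerSeries.X 0 ∣ G j := by
      intro j hj
      have hb : b ≠ 0 := fun hb => hj (by show MvPowerSeries.subst φ b = 0; rw [hb, hφz])
      show MvPowerSeries.subst (CobordantChart.chart w c) (MvPowerSeries.subst Φ (MvPowerSeries.subst φ b)) =
        MvPowerSeries.X 0 ^ D j * G j ∧ ¬ MvPowerSeries.X 0 ∣ G j
      rw [subst_subst_eq_subst_comp hφ0 hΦ0 b]
      exact hDG j hb
    obtain ⟨hlive, hsucc⟩ := hs c hc0 hc D G hDG'
    refine ⟨hlive, fun hne hbad => ?_⟩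
    -- the successors agree: both tuples are non-zero one-entry tuples with the same data
    have hb0 : (fun _ : Fin (0 + 1) => b) 0 ≠ 0 := by
      intro hb
      apply hne
      rw [show (fun _ : Fin (0 + 1) => b) = 0 from funext fun _ => hb]
      funext j
      simp [newTuple]
    have hb0' : (fun _ : Fin (0 + 1) => MvPowerSeries.subst φ b) 0 ≠ 0 :=
      fun h0 => hb0 (eq_zero_of_subst_eq_zero hφ0 hφdet h0)
    rw [newTuple_fin_one _ hb0] at hne hbad ⊢
    rw [newTuple_fin_one _ hb0'] at hsucc
    exact hsucc hne hbad

/-! ## END, INDUCTION, BASE -/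

section End

variable (a : MvPowerSeries (Fin 3) k) {Z₁ : Scheme.{0}} (π : Z₁ ⟶ Spec (.of (MvPowerSeries (Fin 3) k)))
  (X₁ B₁ : Set Z₁)

/-- **END.** At the end of the sequence (`π⁻¹(V a) = X₁ ∪ B₁`, `X₁` closed and transversal to the snc divisor `B₁`, total
transforms non-zero) `TWonAt a π`: every divisor of the total transform is, in a monomial frame, a divisor of a unit-monomial,
won by `TupleMonomial.tWon_of_dvd_unit_mul_prod` and transported back by `tWon_of_tWon_subst`. [OURS · folklore] -/
theorem tWonAt_end (hX₁c : IsClosed X₁) (hB₁ : IsStrictNormalCrossingsDivisor Z₁ B₁)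
    (htot : π ⁻¹' ((Spec (.of (MvPowerSeries (Fin 3) k))).zeroLocus (U := ⊤)
      {(Scheme.ΓSpecIso (.of (MvPowerSeries (Fin 3) k))).inv.hom a} : Set _) = X₁ ∪ B₁)
    (htr : IsTransversalWith Z₁ X₁ B₁) (hT : ∀ z : Z₁, totalGerm π z a ≠ 0) : TWonAt a π := by
  refine tWonAt_of_forall_dvd a π fun z hN F b hb => ?_
  haveI := hN
  obtain ⟨F', u, e, hu, hF'⟩ := exists_monomial_frame_end a π X₁ B₁ hX₁c hB₁ htot htr hT z hN F
  obtain ⟨φ, hφ0, hφdet, hφe⟩ := Frame.exists_subst F F'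
  have hφs : MvPowerSeries.HasSubst φ := MvPowerSeries.hasSubst_of_constantCoeff_zero hφ0
  have hb' : MvPowerSeries.subst φ b ∣ u * ∏ i, MvPowerSeries.X i ^ e i := by
    rw [← hF', hφe, ← MvPowerSeries.coe_substAlgHom hφs]
    exact map_dvd _ hb
  exact tWon_of_tWon_subst hφ0 hφdet (tWon_of_dvd_unit_mul_prod hu e _ hb')

end End

/-- **INDUCTION along the corrected sequence.** `TWonAt a σ → TWonAt a (𝟙 Z₀)` for every corrected `𝓑`-permissible sequence
`σ : Z' ⟶ Z₀` whose starting boundary is a proper closed subset (no characteristic hypothesis). [OURS · folklore] -/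
theorem tWonAt_transformerB (a : MvPowerSeries (Fin 3) k)
    {X B : Set (Spec (.of (MvPowerSeries (Fin 3) k)))} (hB : IsClosed B) (hBne : B ≠ Set.univ)
    {Z' : Scheme.{0}} {σ : Z' ⟶ Spec (.of (MvPowerSeries (Fin 3) k))} {X' B' : Set Z'}
    (hseq : IsBPermissibleSequenceB X B σ X' B') :
    TWonAt a σ → TWonAt a (𝟙 (Spec (.of (MvPowerSeries (Fin 3) k)))) := by
  haveI : IsDomain (MvPowerSeries (Fin 3) k) := NoZeroDivisors.to_isDomain _
  haveI : IsNoetherianRing (MvPowerSeries (Fin 3) k) := isNoetherianRing_mvPowerSeries (Fin 3) (R := k)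
  induction hseq with
  | refl => exact id
  | @blowup Z' Z'' σ X' B' h C τ hτ hreg hsub hBsing hperm hnc ih =>
    intro hW
    obtain ⟨hint, hnoeth, -, hB'c, hB'ne⟩ := forwardB hB hBne h
    haveI := hint
    haveI := hnoeth
    have hC : C ≠ ⊥ := centre_ne_bot_B C hsub hBsing (genericPoint_not_mem_of_isClosed hB'c hB'ne)
    exact ih (tWonAt_of_tWonAt_blowup a σ C τ hτ hreg hC hW)

/-- **BASE.** `TWonAt a (𝟙 Z₀)` wins the position `a` itself (tautological frame at the closed point). [OURS · folklore] -/
theorem tWon_of_tWonAt_id (a : MvPowerSeries (Fin 3) k) (h : TWonAt a (𝟙 (Spec (.of (MvPowerSeries (Fin 3) k)))))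
    (ha : a ≠ 0) (hbad : Bad (fun _ : Fin (0 + 1) => a)) : TWon k 3 0 (fun _ : Fin (0 + 1) => a) := by
  obtain ⟨hN, F, hF⟩ := exists_tautological_frame k
  exact h _ hN F a (by rw [hF]) ha hbad

/-! ## Assembly -/

/-- **Every non-zero bad one-entry position on `k⟦x₀,x₁,x₂⟧` is won**, modulo F-32bR (every field `k`). [OURS · L1 W4.3] -/
theorem tWon_of_CJSB (hCJS : CossartJannsenSaito2020EmbeddedSequenceB.{0}) (k : Type) [Field k]
    (a : MvPowerSeries (Fin 3) k) (ha : a ≠ 0) (hbad : Bad (fun _ : Fin (0 + 1) => a)) :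
    TWon k 3 0 (fun _ : Fin (0 + 1) => a) := by
  obtain ⟨Z₁, π, X₁, B₁, hseq, hB₁, htot, htr⟩ := exists_sequence_zeroLocusB (k := k) hCJS a ha
  have hX₁c : IsClosed X₁ := isClosed_of_seqB hseq (isClosed_zeroLocus (k := k) a)
  haveI : Nonempty (Spec (.of (MvPowerSeries (Fin 3) k))) := ⟨closedPoint (MvPowerSeries (Fin 3) k)⟩
  have hB : IsClosed (∅ : Set (Spec (.of (MvPowerSeries (Fin 3) k)))) := isClosed_empty
  have hBne : (∅ : Set (Spec (.of (MvPowerSeries (Fin 3) k)))) ≠ Set.univ := Set.empty_ne_univ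
  exact tWon_of_tWonAt_id a
    (tWonAt_transformerB a hB hBne hseq (tWonAt_end a π X₁ B₁ hX₁c hB₁ htot htr (totalGerm_ne_zero_B hB hBne hseq ha)))
    ha hbad

/-- **TRACK T4: THE ONE-ENTRY TUPLE GAME ON `k⟦x₀,x₁,x₂⟧` IS WON, MODULO F-32bR** — `TupleGame.Drop k 3 0` for every field `k`:
order reduction of a marked germ `(a₀, 2)` on the regular local threefold `Spec k⟦x₀,x₁,x₂⟧` in the positional form of the
coefficient-tuple game, from the corrected Cossart–Jannsen–Saito embedded resolution sequence for the surface `V(a₀)`.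
[OURS · L1 W4.3 · chain w43 Track T4; CONDITIONAL on the named printed fact] -/
theorem tupleDropThreeZero_of_CJSB (hCJS : CossartJannsenSaito2020EmbeddedSequenceB.{0}) (k : Type) [Field k] :
    TupleGame.Drop k 3 0 := by
  refine drop_of_allTWon fun a ha hbad => ?_
  have ha0 : a 0 ≠ 0 := by
    intro h0
    apply ha
    funext j
    have hj : j = 0 := Fin.ext (by have := j.isLt; omega)
    rw [hj, h0]; rfl
  have haeq : a = fun _ : Fin (0 + 1) => a 0 := by
    funext j
    have hj : j = 0 := Fin.ext (by have := j.isLt; omega)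
    rw [hj]
  rw [haeq] at hbad ⊢
  exact tWon_of_CJSB hCJS k (a 0) ha0 hbad

end Summit.ResolutionOfSingularities.ResolutionOfSingularities.Theorems.TrackT4

end
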